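import Mathlib
import HarnessLib
import Literature.Computability.AlgebraicComplexity.PatternExpressions
import Literature.Combinatorics.SimpleGraph.TreeDecomposition
import Summits.ValiantsHypothesis.ValiantsHypothesis.Theorems.MonotoneRestorationOrbitRestorationQPBipartiteSplittingDoubleCover

/-!
# Route MonotoneRestoration, crux `MonotoneRestorationQP` (stmt-15886), line `linear-width` —
# the width hypothesis is blind to odd cycles: the adjacency matrices of `X ⊔ X` and of the bipartite double cover `X × K₂`
# are hom-indistinguishable at EVERY treewidth

Helper file (`--supports stmt-ValiantsHypothesis-15886`), def-free.  The graded family `WidthRung d` of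
`Cruxes/MonotoneRestorationQP/Lines/linear_width.lean` carries the width hypothesis `PolylogHomDetermined f` built from
`HomIndist n k A B` — equality at `A, B ∈ ℂ^{n×n}` of the homomorphism polynomials of BIPARTITE multigraph patterns of treewidth `< k`.
Homomorphism polynomials are matrix-symmetric (`rename_perm_homPoly`), so ALIGNED points (`A (σ i, τ j) = B (i, j)`) are
hom-indistinguishable at every `k` (`DeterminedSymmetric.homIndist_perm`); with the doubling/double-cover alignment of
`…BipartiteSplittingDoubleCover.lean` (crux 18293, this hand) this gives, for simple graphs realised as `0/1` points:

* `eval_homPoly_indicator_eq_of_adj_iff` — aligned adjacency relations ⇒ equal values of every `hom_{E,n}` (no treewidth bound);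
* `homIndist_twoCopies_doubleCover` — **for every simple graph `X` on `Fin m` and every `k`, the adjacency matrices (on `Fin (2m)`,
  via `finProdFinEquiv`) of the doubling `X ⊔ X` and of the bipartite double cover `X × K₂` satisfy `HomIndist (2m) k`
  (unfolded verbatim)** — although for non-bipartite `X` the two GRAPHS are distinguished by an odd-cycle count, i.e. by
  homomorphism counts from NON-bipartite patterns of treewidth `2`: the identification "HomIndist = `C^k`-equivalence" in the
  docstring of `HomIndist` holds for the bipartite double covers / for bipartite patterns only;
* `nonempty_iso_twoCopies_doubleCover_of_coloring`, `nonempty_iso_twoCopies_doubleCover_iff` — for BIPARTITE `X` the two graphs are even isomorphic (`(s,v) ↦ (s + χ v, v)` for a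
  `2`-colouring `χ`), complementing `BipartiteSplitting.not_iso_twoCopies_doubleCover` (non-isomorphic when `X` is not bipartite).

Honest label: bookkeeping on the line's width hypothesis; no stub closed; VP ≠ VNP not moved. [folklore]
-/

-- `Summit.ValiantsHypothesis.ValiantsHypothesis.…` is the tree's mandated namespace (Sub = Summit).
set_option linter.dupNamespace false

noncomputable section

open scoped Classical

namespace Summit.ValiantsHypothesis.ValiantsHypothesis.Theorems

namespace DoubleCoverHomIndist

open Literature.Computability.AlgebraicComplexity MvPolynomial OrbitRestorationQPDepthThreeRung

/-- **Aligned adjacency relations give equal values of every homomorphism polynomial** (any pattern, any treewidth).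
[folklore] -/
theorem eval_homPoly_indicator_eq_of_adj_iff {n : ℕ} (X Y : SimpleGraph (Fin n)) (σ τ : Equiv.Perm (Fin n))
    (h : ∀ i j, X.Adj (σ i) (τ j) ↔ Y.Adj i j) {a b : ℕ} (E : Multiset (Fin a × Fin b)) :
    eval (Set.indicator {ij : Fin n × Fin n | X.Adj ij.1 ij.2} 1) (homPoly E n ℂ) =
      eval (Set.indicator {ij : Fin n × Fin n | Y.Adj ij.1 ij.2} 1) (homPoly E n ℂ) :=
  BipartiteSplitting.eval_indicator_eq_of_adj_iff (homPoly E n ℂ) (rename_perm_homPoly E n ℂ) X Y σ τ h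

/-- **The width hypothesis never separates the doubling from the double cover.**  For every simple graph `X` on `Fin m` and every
`k`, the `0/1` adjacency matrices on `Fin (2m)` of `X ⊔ X` and of `X × K₂` are hom-indistinguishable below treewidth `k`
(`HomIndist (2m) k` of line `linear-width`, unfolded verbatim) — indeed at every treewidth. [folklore] -/
theorem homIndist_twoCopies_doubleCover {m : ℕ} (X : SimpleGraph (Fin m)) (k : ℕ) :
    ∀ (a b : ℕ) (E : Multiset (Fin a × Fin b)),
      Literature.Combinatorics.SimpleGraph.treewidth
        (SimpleGraph.fromRel fun u v : Fin a ⊕ Fin b => ∃ p ∈ E, u = Sum.inl p.1 ∧ v = Sum.inr p.2) < k →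
      eval (Set.indicator {ij : Fin (2 * m) × Fin (2 * m) |
          ((SimpleGraph.fromRel fun p q : Fin 2 × Fin m => p.1 = q.1 ∧ X.Adj p.2 q.2).comap
            (finProdFinEquiv.symm : Fin (2 * m) → Fin 2 × Fin m)).Adj ij.1 ij.2} 1) (homPoly E (2 * m) ℂ) =
        eval (Set.indicator {ij : Fin (2 * m) × Fin (2 * m) |
          ((SimpleGraph.fromRel fun p q : Fin 2 × Fin m => p.1 ≠ q.1 ∧ X.Adj p.2 q.2).comap
            (finProdFinEquiv.symm : Fin (2 * m) → Fin 2 × Fin m)).Adj ij.1 ij.2} 1) (homPoly E (2 * m) ℂ) := by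
  intro a b E _
  obtain ⟨σ, τ, h⟩ := BipartiteSplitting.doubleCover_aligned_fin X
  exact (eval_homPoly_indicator_eq_of_adj_iff _ _ σ τ h E).symm

/-- In `Fin 2`: translating by two DIFFERENT colours separates equal coordinates and identifies different ones. [folklore] -/
theorem fin_two_add_ne_add_iff : ∀ s s' c c' : Fin 2, c ≠ c' → (s + c ≠ s' + c' ↔ s = s') := by
  decide

/-- In `Fin 2`: `c + c = 0`. [folklore] -/
theorem fin_two_add_self : ∀ c : Fin 2, c + c = 0 := by
  decide

/-- **For bipartite `X` the doubling and the double cover are isomorphic**: given a proper `2`-colouring `χ`, the involution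
`(s, v) ↦ (s + χ v, v)` maps `X ⊔ X` onto `X × K₂`. [folklore] -/
theorem nonempty_iso_twoCopies_doubleCover_of_coloring {V : Type*} (X : SimpleGraph V) (χ : X.Coloring (Fin 2)) :
    Nonempty ((SimpleGraph.fromRel fun p q : Fin 2 × V => p.1 = q.1 ∧ X.Adj p.2 q.2) ≃g
      (SimpleGraph.fromRel fun p q : Fin 2 × V => p.1 ≠ q.1 ∧ X.Adj p.2 q.2)) := by
  refine ⟨{ toFun := fun p => (p.1 + χ p.2, p.2)
            invFun := fun p => (p.1 + χ p.2, p.2)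
            left_inv := ?_
            right_inv := ?_
            map_rel_iff' := ?_ }⟩
  · rintro ⟨s, v⟩
    simp only [Prod.mk.injEq, and_true]
    rw [add_assoc, fin_two_add_self, add_zero]
  · rintro ⟨s, v⟩
    simp only [Prod.mk.injEq, and_true]
    rw [add_assoc, fin_two_add_self, add_zero]
  · rintro ⟨s, v⟩ ⟨s', v'⟩
    simp only [Equiv.coe_fn_mk, SimpleGraph.fromRel_adj, ne_eq, Prod.mk.injEq]
    constructor
    · rintro ⟨-, (⟨h1, h2⟩ | ⟨h1, h2⟩)⟩
      · have hc : χ v ≠ χ v' := χ.valid h2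
        exact ⟨fun h => h2.ne h.2, Or.inl ⟨(fin_two_add_ne_add_iff s s' _ _ hc).1 h1, h2⟩⟩
      · have hc : χ v' ≠ χ v := χ.valid h2
        exact ⟨fun h => h2.ne h.2.symm, Or.inl ⟨((fin_two_add_ne_add_iff s' s _ _ hc).1 h1).symm, h2.symm⟩⟩
    · rintro ⟨-, (⟨h1, h2⟩ | ⟨h1, h2⟩)⟩
      · have hc : χ v ≠ χ v' := χ.valid h2
        exact ⟨fun h => h2.ne h.2, Or.inl ⟨(fin_two_add_ne_add_iff s s' _ _ hc).2 h1, h2⟩⟩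
      · have hc : χ v ≠ χ v' := fun h => χ.valid h2 h.symm
        exact ⟨fun h => h2.ne h.2.symm, Or.inl ⟨(fin_two_add_ne_add_iff s s' _ _ hc).2 h1.symm, h2.symm⟩⟩

/-- Hence for `2`-colourable `X` the pair is trivially useless (isomorphic), while for non-`2`-colourable `X` it is non-isomorphic
(`BipartiteSplitting.not_iso_twoCopies_doubleCover`) but still aligned: in neither case can it witness a separation. [folklore] -/
theorem nonempty_iso_twoCopies_doubleCover_iff {V : Type*} (X : SimpleGraph V) :
    Nonempty ((SimpleGraph.fromRel fun p q : Fin 2 × V => p.1 = q.1 ∧ X.Adj p.2 q.2) ≃g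
      (SimpleGraph.fromRel fun p q : Fin 2 × V => p.1 ≠ q.1 ∧ X.Adj p.2 q.2)) ↔ X.Colorable 2 := by
  constructor
  · intro ⟨e⟩
    by_contra hX
    exact (BipartiteSplitting.not_iso_twoCopies_doubleCover X hX).false e
  · intro ⟨χ⟩
    exact nonempty_iso_twoCopies_doubleCover_of_coloring X χ

end DoubleCoverHomIndist

end Summit.ValiantsHypothesis.ValiantsHypothesis.Theorems

end
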